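import Summits.HubbardSuperconductivity.HubbardSuperconductivity.Theorems.AnisotropyChordTransferFibre3RateLemma

/-!
# Route `AnisotropyChord` / H0 rotor rung: PartN39 — `EisensteinLambert` PROVED (`E₂(i) = 3/π` in Lambert form)

`eisensteinLambert_holds : RateLemma.EisensteinLambert` (`…Fibre3RateLemma`, PORT PartN39, memo ROTOR-THEORY-21 §322):
`Σ_{n≥1} n/(e^{2πn} − 1) = 1/24 − 1/(8π)` — the classical value that makes the torus periodisation correction of the
`λ = 0` kernel isotropic (`π/12 − 2π(1/24 − 1/8π) = 1/4`).

The typed statement's docstring says «classical; NOT in Mathlib»; the ingredients ARE in current Mathlib and this file only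
assembles them: `EisensteinSeries.G2_S_transform` (`G₂(z) = z⁻²G₂(S•z) + 2πi/z`) at the fixed point `z = i` of `S` gives
`G₂(i) = π` (`G2_I`), hence `E₂(i) = G₂(i)/(2ζ(2)) = 3/π` (`riemannZeta_two`, `E2_I`); the q-expansion
`EisensteinSeries.E2_eq_tsum_cexp` (`E₂ = 1 − 24 Σ σ₁(n) qⁿ`) at `q = e^{−2π}` and the Lambert rearrangement
`tsum_pow_div_one_sub_eq_tsum_sigma` (`Σ n qⁿ/(1−qⁿ) = Σ σ₁(n) qⁿ`) give the complex identity (`lambert_sum_complex`);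
the rest is the passage to `ℝ`, summability by comparison with `Σ n qⁿ`, and the reindexing `ℕ+ ≃ ℕ`.
Prover seat `hubbard-h0-rotor-p3` g2; helper for stmt-HubbardSuperconductivity-19089 (`--supports`, helper class).
Nothing here proves superconductivity in the Hubbard model; helper lemmas of ONE conditional reduction (rung 19089).
Mathlib + the tree only; no sorry.
-/

set_option linter.dupNamespace false
set_option autoImplicit false

noncomputable section

open scoped BigOperators

namespace Summit.HubbardSuperconductivity.HubbardSuperconductivity.Theorems.AnisotropyChord.Transfer.Fibre3

/-- `G₂(i) = π` (from the `S`-transformation law at its fixed point `i`; the fixed-point fact `S • i = i` is the tree's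
`Literature.NumberTheory.EllipticCurves.ModularForms.S_smul_I`, re-derived inline to keep the import light).
[folklore; Mathlib `EisensteinSeries.G2_S_transform`] -/
theorem G2_I : EisensteinSeries.G2 UpperHalfPlane.I = Real.pi := by
  have hS : ModularGroup.S • UpperHalfPlane.I = UpperHalfPlane.I := by
    apply UpperHalfPlane.ext
    rw [UpperHalfPlane.modular_S_smul]
    show (-(UpperHalfPlane.I : ℂ))⁻¹ = (UpperHalfPlane.I : ℂ)
    rw [UpperHalfPlane.coe_I, inv_neg, Complex.inv_I, neg_neg]
  have h := EisensteinSeries.G2_S_transform UpperHalfPlane.I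
  rw [hS, UpperHalfPlane.coe_I, Complex.I_sq] at h
  have e : -2 * (Real.pi : ℂ) * Complex.I / Complex.I = -2 * Real.pi := by
    rw [mul_div_assoc, div_self Complex.I_ne_zero, mul_one]
  rw [e, inv_neg, inv_one] at h
  linear_combination (1 / 2 : ℂ) * h

/-- `E₂(i) = 3/π`. [folklore] -/
theorem E2_I : EisensteinSeries.E2 UpperHalfPlane.I = 3 / Real.pi := by
  have h : EisensteinSeries.E2 UpperHalfPlane.I
      = (1 / (2 * riemannZeta 2)) * EisensteinSeries.G2 UpperHalfPlane.I := by
    simp [EisensteinSeries.E2]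
  rw [h, G2_I, riemannZeta_two]
  have hpi : (Real.pi : ℂ) ≠ 0 := by exact_mod_cast Real.pi_ne_zero
  field_simp
  ring

/-- the Lambert sum at `q = e^{−2π}` over `ℂ`: `Σ_{n≥1} n qⁿ/(1 − qⁿ) = (1 − 3/π)/24`. [folklore] -/
theorem lambert_sum_complex :
    ∑' n : ℕ+, ((n : ℕ) : ℂ) * ((Real.exp (-(2 * Real.pi)) : ℝ) : ℂ) ^ (n : ℕ)
        / (1 - ((Real.exp (-(2 * Real.pi)) : ℝ) : ℂ) ^ (n : ℕ))
      = (1 - 3 / (Real.pi : ℂ)) / 24 := by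
  set r : ℂ := ((Real.exp (-(2 * Real.pi)) : ℝ) : ℂ) with hr
  have hrn : ‖r‖ < 1 := by
    rw [hr, Complex.norm_real, Real.norm_eq_abs, abs_of_pos (Real.exp_pos _)]
    exact Real.exp_lt_one_iff.mpr (by linarith [Real.pi_pos])
  have hq : Complex.exp (2 * (Real.pi : ℂ) * Complex.I * (UpperHalfPlane.I : ℂ)) = r := by
    rw [UpperHalfPlane.coe_I, hr, Complex.ofReal_exp]
    congr 1
    rw [mul_assoc, Complex.I_mul_I]
    push_cast
    ring
  have h1 := EisensteinSeries.E2_eq_tsum_cexp UpperHalfPlane.I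
  rw [E2_I, hq] at h1
  have h2 := tsum_pow_div_one_sub_eq_tsum_sigma hrn 1
  simp only [pow_one] at h2
  rw [h2]
  linear_combination (1 / 24 : ℂ) * h1

/-- **`EisensteinLambert` holds**: `Σ_{n≥1} n/(e^{2πn} − 1) = 1/24 − 1/(8π)` (as the typed `HasSum` over `ℕ`,
`n ↦ (n+1)/(e^{2π(n+1)} − 1)`). -/
theorem eisensteinLambert_holds : RateLemma.EisensteinLambert := by
  unfold RateLemma.EisensteinLambert
  set ρ : ℝ := Real.exp (-(2 * Real.pi)) with hρ
  have hρpos : 0 < ρ := Real.exp_pos _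
  have hρ1 : ρ < 1 := by rw [hρ]; exact Real.exp_lt_one_iff.mpr (by linarith [Real.pi_pos])
  set g : ℕ+ → ℝ := fun n => ((n : ℕ) : ℝ) * ρ ^ (n : ℕ) / (1 - ρ ^ (n : ℕ)) with hg
  -- summability by comparison with `Σ n ρⁿ/(1 − ρ)`
  have hgs : Summable g := by
    have hs : Summable (fun n : ℕ => (n : ℝ) ^ 1 * ρ ^ n) :=
      summable_pow_mul_geometric_of_norm_lt_one 1 (by rwa [Real.norm_eq_abs, abs_of_pos hρpos])
    have hs' : Summable (fun n : ℕ+ => ((n : ℕ) : ℝ) ^ 1 * ρ ^ (n : ℕ) / (1 - ρ)) :=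
      (hs.div_const (1 - ρ)).comp_injective PNat.coe_injective
    refine Summable.of_nonneg_of_le (fun n => ?_) (fun n => ?_) hs'
    · have : ρ ^ (n : ℕ) ≤ 1 := pow_le_one₀ hρpos.le hρ1.le
      rw [hg]
      dsimp only
      apply div_nonneg (by positivity)
      linarith
    · have hn : ρ ^ (n : ℕ) ≤ ρ := by
        calc ρ ^ (n : ℕ) = ρ ^ ((n : ℕ) - 1) * ρ := by rw [← pow_succ, Nat.sub_add_cancel n.pos]
          _ ≤ 1 * ρ := by
              apply mul_le_mul_of_nonneg_right (pow_le_one₀ hρpos.le hρ1.le) hρpos.le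
          _ = ρ := one_mul ρ
      rw [hg]
      dsimp only
      rw [pow_one]
      exact div_le_div_of_nonneg_left (by positivity) (by linarith) (by linarith)
  -- the value of the sum, through `ℂ`
  have hval : ∑' n : ℕ+, g n = 1 / 24 - 1 / (8 * Real.pi) := by
    apply Complex.ofReal_injective
    rw [Complex.ofReal_tsum]
    have e : ∀ n : ℕ+, ((g n : ℝ) : ℂ)
        = ((n : ℕ) : ℂ) * ((ρ : ℝ) : ℂ) ^ (n : ℕ) / (1 - ((ρ : ℝ) : ℂ) ^ (n : ℕ)) := by
      intro n
      rw [hg]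
      push_cast
      ring
    simp only [e]
    rw [hρ, lambert_sum_complex]
    have hpi : (Real.pi : ℂ) ≠ 0 := by exact_mod_cast Real.pi_ne_zero
    push_cast
    field_simp
    ring
  have hsum : HasSum g (1 / 24 - 1 / (8 * Real.pi)) := hval ▸ hgs.hasSum
  -- reindex `ℕ+ ≃ ℕ`
  have h := (Equiv.hasSum_iff Equiv.pnatEquivNat.symm (f := g)).mpr hsum
  convert h using 1
  ext n
  simp only [Function.comp_apply, Equiv.pnatEquivNat_symm_apply, hg, Nat.succPNat_coe, Nat.cast_succ]
  -- `(n+1)/(e^{2π(n+1)} − 1) = (n+1) ρ^{n+1}/(1 − ρ^{n+1})`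
  have hp : ρ ^ (n + 1) = Real.exp (-(2 * Real.pi * ((n : ℝ) + 1))) := by
    rw [hρ, ← Real.exp_nat_mul]
    congr 1
    push_cast
    ring
  have hprod : Real.exp (-(2 * Real.pi * ((n : ℝ) + 1))) * Real.exp (2 * Real.pi * ((n : ℝ) + 1)) = 1 := by
    rw [← Real.exp_add, neg_add_cancel, Real.exp_zero]
  have hgt : 1 < Real.exp (2 * Real.pi * ((n : ℝ) + 1)) :=
    Real.one_lt_exp_iff.mpr (by positivity)
  have hlt : Real.exp (-(2 * Real.pi * ((n : ℝ) + 1))) < 1 :=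
    Real.exp_lt_one_iff.mpr (by have := Real.pi_pos; nlinarith [n.cast_nonneg (α := ℝ)])
  rw [hp, div_eq_div_iff (by linarith) (by linarith)]
  linear_combination (-((n : ℝ) + 1)) * hprod

end Summit.HubbardSuperconductivity.HubbardSuperconductivity.Theorems.AnisotropyChord.Transfer.Fibre3

end
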